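/-
Copyright: cell `langlands-arthur-audit` (papers/Langlands/langlands-arthur-audit), units `pub-arthur-typer` (gen 1)
and `pub-arthur-typer-g2`.  Staged for the tree under `Literature/NumberTheory/Automorphic/Arthur2013/`
(LEAN-IN-TREE rule 2026-08-18) from the cell file `HOME/lean/extras/LeavesMathlibDictionary.lean` (gen 1, farm rc 0):
namespace renamed, the tag inductives now IMPORTED from module `Leaves` instead of re-declared, provenance tags added.
File AFTER `Leaves/Packets.lean` (module map: M5 ← M3 parts 1, 4).
-/
import Mathlib
import Literature.NumberTheory.Automorphic.Arthur2013.Leaves.Packets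
import HarnessLib

/-!
# Arthur (2013) audit — dictionary: scope tags of module `Leaves` ↦ Mathlib vocabulary

The files `Scopes` … `Register` of this directory quantify over decidable TAGS (`Leaves.LocalKind`, `Leaves.GlobalKind`, …) so that regions and
their (non-)containments are settled by `decide`.  This module pins what a tag MEANS in Mathlib terms, so that the
printed hypothesis "F a non-archimedean local field of characteristic zero" ([AGIKMS] = arXiv:2410.13504v3
`note30.tex:L2038` "Assume that $F$ is a non-archimedean local field of characteristic zero."; [MW I] 1.1) is
literally `IsNonarchimedeanLocalField F ∧ CharZero F`, and "F a number field" is `NumberField F`.  It also gives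
the Mathlib form of the component group `A_ψ` of [AGIKMS] §2.5 as the `ZMod 2`-module `Fin t → ZMod 2` with
`A_ψ⁰` an `AddSubgroup` and `det` an `AddMonoidHom`, over the SAME combinatorial shapes `Leaves.ParamShape` whose
characters module `Leaves` presents as `Bool`-vectors (§5 there; DIVERGENCE D-TY-12, D-TY-13).  Sources and their
status: as in the module docstring of `Leaves`.  Nothing here is a theorem about automorphic forms; the two
`example`s only certify that `ℚ` and `ℝ` realise their tags.  No `axiom`, `sorry`, `opaque`.
-/

set_option autoImplicit false

namespace Literature.NumberTheory.Automorphic.Arthur2013.Leaves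

/-- A realisation of a local tag by an actual topological field carrying the Mathlib structure the tag names:
`real ↦ F ≃+* ℝ`, `complex ↦ F ≃+* ℂ`, `nonarch p c0 ↦` a `ValuativeRel` making `F` a non-archimedean local
field (Mathlib `IsNonarchimedeanLocalField`: valuative topology, locally compact, non-trivially valued) of
characteristic `0` (`CharZero F`) resp. `p` (`CharP F p`), `p` prime.  (The residue characteristic is tied to
`p` only in the `CharP` case; DIVERGENCE D-TY-12.)
[folklore] (standard meaning of "local field"; the dictionary itself is the audit's) -/
structure LocalRealisation (k : LocalKind) where
  /-- the field -/
  F : Type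
  /-- its field structure -/
  [instField : Field F]
  /-- its topology -/
  [instTop : TopologicalSpace F]
  /-- the Mathlib reading of the tag -/
  spec : match k with
    | .real => Nonempty (F ≃+* ℝ)
    | .complex => Nonempty (F ≃+* ℂ)
    | .nonarch p c0 => ∃ v : ValuativeRel F,
        @IsNonarchimedeanLocalField F instField v instTop ∧ Nat.Prime p ∧
        (cond c0 (CharZero F) (CharP F p) : Prop)

/-- A realisation of a global tag: `numberField ↦ NumberField F` (Mathlib: characteristic zero and finite
dimensional over `ℚ`); `functionField p ↦` characteristic `p`, `p` prime (schematic: no global function field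
class is pinned, DIVERGENCE D-TY-12). [folklore] (standard meaning of "number field") -/
structure GlobalRealisation (k : GlobalKind) where
  /-- the field -/
  F : Type
  /-- its field structure -/
  [instField : Field F]
  /-- the Mathlib reading of the tag -/
  spec : match k with
    | .numberField => NumberField F
    | .functionField p => CharP F p ∧ Nat.Prime p

/-- `ℚ` realises the number-field tag. [folklore] (sanity check of the dictionary) -/
example : GlobalRealisation .numberField := { F := ℚ, spec := inferInstance }

/-- `ℝ` realises the real tag. [folklore] (sanity check of the dictionary) -/
noncomputable example : LocalRealisation .real := { F := ℝ, spec := ⟨RingEquiv.refl ℝ⟩ }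

/-! ## The component group of [AGIKMS] §2.5 over `ZMod 2`, on the shapes of module `Leaves` -/

namespace ComponentGroup

variable {Λ : Type}

/-- `A_ψ = ⊕_{i=1}^t ℤ/2ℤ e(φ_i,d_i)` ([AGIKMS] `note30.tex:L1400` "A_{\psi} = \bigoplus_{i = 1}^t \Z/2\Z
e(\phi_i, d_i)."). [claim: AGIKMS2024, under-review] (§2.5 notation, l.1400) -/
abbrev A (ψ : ParamShape Λ) : Type := Fin ψ.k → ZMod 2

/-- basis vector `e(φ_i,d_i)`. [claim: AGIKMS2024, under-review] (§2.5 notation, l.1400) -/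
def e (ψ : ParamShape Λ) (i : Fin ψ.k) : A ψ := Pi.single i 1

/-- `z_ψ = Σ_i e(φ_i,d_i)` (`note30.tex:L1413` "Finally, set $z_{\psi} = \sum_{i=1}^t e(\phi_i, d_i)$.").
[claim: AGIKMS2024, under-review] (§2.5 notation, l.1413) -/
def z (ψ : ParamShape Λ) : A ψ := fun _ => 1

/-- `s_ψ = Σ_{d_i even} e(φ_i,d_i)` (`note30.tex:L1501–L1503`). [claim: AGIKMS2024, under-review] (§2.5, l.1501-1503) -/
def s (ψ : ParamShape Λ) : A ψ := fun i => if ψ.d i % 2 = 0 then 1 else 0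

/-- `A_ψ⁰`, generated by the `e(φ_i,d_i) + e(φ_j,d_j)` with `φ_i ⊠ S_{d_i} ≅ φ_j ⊠ S_{d_j}`
(`note30.tex:L1407–L1411`). [claim: AGIKMS2024, under-review] (§2.5, l.1407-1411) -/
def A0 (ψ : ParamShape Λ) : AddSubgroup (A ψ) :=
  AddSubgroup.closure {a | ∃ i j, ψ.lbl i = ψ.lbl j ∧ ψ.d i = ψ.d j ∧ a = e ψ i + e ψ j}

/-- `det : A_ψ → ℤ/2ℤ`, `e(φ_i,d_i) ↦ dim(φ_i ⊠ S_{d_i}) mod 2` (`note30.tex:L1403–L1406`).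
[claim: AGIKMS2024, under-review] (§2.5, l.1403-1406) -/
def det (ψ : ParamShape Λ) : A ψ →+ ZMod 2 where
  toFun a := ∑ i, a i * ((ψ.dimφ i * ψ.d i : ℕ) : ZMod 2)
  map_zero' := by simp
  map_add' a b := by
    simp only [Pi.add_apply, add_mul]
    exact Finset.sum_add_distrib

/-- characters of `𝒮_ψ ≅ A_ψ/(A_ψ⁰ + ℤ/2ℤ z_ψ)` (`note30.tex:L1426–L1428`, the `SO_{2n+1}` / `U_n` case) as
additive characters of `A_ψ` trivial on `A_ψ⁰` and on `z_ψ`; module `Leaves` uses the equivalent `Bool`-vector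
presentation `Leaves.ParamShape.AChar` (DIVERGENCE D-TY-13). [claim: AGIKMS2024, under-review] (§2.5, l.1426-1428) -/
structure AChar (ψ : ParamShape Λ) where
  /-- the additive character -/
  χ : A ψ →+ ZMod 2
  /-- trivial on `A_ψ⁰` -/
  triv_A0 : ∀ a ∈ A0 ψ, χ a = 0
  /-- trivial on `z_ψ` -/
  triv_z : χ (z ψ) = 0

/-- the sign `⟨s_ψ, χ⟩ ∈ {±1} ⊂ ℂ` entering (ECR1) (`note30.tex:L1494–L1503`).
[claim: AGIKMS2024, under-review] (§2.5, l.1494-1503) -/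
noncomputable def AChar.atS {ψ : ParamShape Λ} (c : AChar ψ) : ℂ := if c.χ (s ψ) = 0 then 1 else -1

end ComponentGroup

end Literature.NumberTheory.Automorphic.Arthur2013.Leaves
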